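import Literature.AlgebraicGeometry.Milne1999.LefschetzGroup
import Literature.AlgebraicGeometry.HodgeTheory.HodgeGroupExteriorAction
import Literature.AlgebraicGeometry.Deligne1982.HodgeGroupCommutantHOne
import HarnessLib

/-!
# Milne's centraliser `C(A)` and the groups `S(A)`, `G(A)` of a complex abelian variety, on `H¹` (Milne 1999, Duke 96, §1 and Thm. 4.4)

Family `hodge`, layer `Literature/AlgebraicGeometry/Milne1999`, namespace
`Literature.AlgebraicGeometry.Milne1999` (D-0022). Companion of `Milne1999/LefschetzGroup` (the
invariant-theoretic, Tannaka-free `L(A)`, `S(A) = ker l(A)` as stabilisers of the Lefschetz classes on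
the powers); written for the cell `pub-hodgecm2` (COR-CM, Hodge ladder stage 2), literature fan-out plan
`HOME/lit/LIT-FANOUT-PLAN.md` §B-v3 row **INFRA-04-2′** ("Lefschetz group, CENTRALISER SIDE + Thm 4.4
bridge"), binder table `HOME/lit/milne.md` rows M8–M10. This file exposes the CENTRALISER side of
Milne's paper, which `LefschetzGroup.lean` lists under "NOT here": the algebra `C(A)`, the groups
`S(A) ⊆ G(A)` and their relation to the Hodge group, as concrete subgroups of `GL(H¹(A(ℂ); ℂ))`.

## Source read (held text `paper:doi-10-1215-s0012-7094-99-09620-5` = J. S. Milne, *Lefschetz classes on abelian varieties*, Duke Math. J. 96 (1999) 639–675, author version 1999aP), verbatim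

* §1, p. 642 (held p0004 L58–L77): "For an abelian variety `A` over `Ω`, we define `V(A)` to be the
  dual of `H¹(A)`. […] A divisor `D` on `A` defines a class `cl(D)` in `H²(A)(1)` and […] a
  skew-symmetric pairing `e_D : V(A) × V(A) → k(1)`. When `D` is ample, `e_D` is nondegenerate, and we
  let `β†` denote the adjoint with respect to `e_D` […]: `e_D(βx, y) = e_D(x, β†y)`. […] **The
  `k`-algebra `C(A)`.** For an abelian variety `A` over `Ω`, we define `C(A)` to be the centralizer of
  `End⁰(A)` in `End_k(V(A))`: `C(A) = End_{End⁰(A) ⊗_ℚ k}(V(A))`."; p. 643 (p0005 L5–L6): "Then `C(A)`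
  is a `k`-algebra stable under the involution `†` defined by an ample divisor `D`, and the restriction
  of `†` to `C(A)` is independent of the choice of `D`."; (p0005 L12–L13) "the diagonal action of
  `C(A)` on `rV(A)` identifies `C(A)` with `C(A^r)`"; **Remark 1.2** (p0005 L32–L33): "the centralizer
  of `C(A)` in `End_k(V(A))` is `End⁰(A) ⊗_ℚ k`."
* §1, p. 644 (p0006 L16–L22): "**The group `S(A)`.** For an abelian variety `A` over `Ω`, we define
  `S(A)` to be the algebraic subgroup of `GL(V(A))` such that, for all commutative `k`-algebras `R`,
  `S(A)(R) = {γ ∈ C(A) ⊗_k R | γ†γ = 1}`. Thus, for any ample divisor `D` on `A`, `S(A)` is the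
  largest algebraic subgroup of `Sp(e_D)` whose elements commute with the endomorphisms of `A`.
  Clearly `S(A)` depends only on the isogeny class of `A`".
* §4, p. 659 (p0021 L10–L15): "Let `G(A)` be the algebraic subgroup of `GL(V(A))` such that
  `G(A)(R) = {γ ∈ C(A) ⊗ R | γ†γ ∈ R^×}` for any `k`-algebra `R`. Thus, for any ample divisor `D` on
  `A`, `G(A)` is the largest algebraic subgroup of `GSp(E^D)` commuting with the endomorphisms of `A`.
  **Theorem 4.4.** The map `γ ↦ (γ, γ†γ) : G(A) → GL(V(A)) × 𝔾_m` sends `G(A)` isomorphically onto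
  `L(A)`." Proof, first half (p0021 L16–L20): "For any `γ ∈ G(A)(k)` and divisor `D` on `A`,
  `e_D(γx, γy) = e_D(x, γ†γx) = γ†γ · e_D(x, y)`, all `x, y ∈ V(A)`, and so `(γ, γ†γ)` fixes `e_D`
  […] This shows that `G(A) ⊂ L(A)`. For the converse, note that Theorem 3.2 implies that
  `H^{2*}(A^r)(*)^{G(A)} = D_hom(A^r)_k` for all `r`, and so a variant of Chevalley's theorem (Deligne
  1982, 3.1) implies that `L(A) = G(A)`."; (p0021 L28–L34) "The projection map `GL(V(A)) × 𝔾_m → 𝔾_m`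
  defines a cocharacter of `L(A)`, which we denote `l(A)` […]. The theorem shows that the kernel of
  `l(A)`, regarded as a subgroup of `GL(V(A))`, equals `S(A)`. It is clear from the theorem that the
  homomorphism `a ↦ (a⁻¹, a⁻²) : 𝔾_m → GL(V(A)) × 𝔾_m` takes values in `L(A)`."
* §4, p. 660 (p0022 L27–L35): "The Hodge group `Hg(A)` of `A` is defined to be the largest algebraic
  subgroup of `GL(V_B(A)) × 𝔾_m` fixing all the Hodge classes on `A` and its powers. […] Clearly
  `D_hom(A) ⊂ H(A)`, and so `L(A) ⊃ Hg(A)`."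
* Milne, *Lefschetz motives and the Tate conjecture*, Compositio Math. 117 (1999) 47–81
  [`paper:doi-10-1023-a-1000776613765`], §1 p. 52 (held p0008 L5–L16): "Let `H₁(A)` be the linear
  dual of `H¹(A)`, and let `C(A)` be the centralizer of `End⁰(A)` in `End(H₁(A))`. A polarization
  `λ : A → A^∨` of `A` determines an involution `α ↦ α† = H₁(λ)⁻¹ ∘ H₁(α^∨) ∘ H₁(λ)` of `End(H₁(A))`
  whose restriction to `C(A)` is independent of the choice of `λ`. The Lefschetz group `L(A)` of `A` is
  the algebraic subgroup of `GL(H₁(A)) × 𝔾_m` such that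
  `L(A)(R) = {(γ, c) ∈ (C(A) ⊗ R)^× × R^× | γ†γ = c}` for all `ℚ`-algebras `R` (Milne (1999a), 4.3,
  4.4). It is reductive (not necessarily connected), and `(γ, c) ↦ c` is a homomorphism
  `l(A) : L(A) → 𝔾_m` rational over `ℚ`."

## Lean rendering (the tree's carriers; `ℂ`-points; everything read on `H¹`)

As in `Milne1999/LefschetzGroup` and `VanGeemen1994/WeilTypeHodgeGroupSU` (whose `weilUnitaryGroup` —
van Geemen's `U_H(ℂ)`: automorphisms of `H¹(A(ℂ); ℂ)` commuting with ONE `φ^*` and preserving the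
polarization pairing — is the one-endomorphism prototype of `S(A)` below), the groups are subgroups
of `GL(H¹(A(ℂ); ℂ))`, `H¹(A(ℂ); ℂ) = complexBetti A.X 1 = V(A)^∨ ⊗ ℂ`, on which `End(A)` acts by the
pull-backs `φ^* = VanGeemen1994.pullbackOne A φ` and `GL(V(A))` by `γ ↦ (γ^∨)⁻¹` (Milne p. 658: "a
natural left action of `GL(V(A))` on `Hˢ(A^r)`"). The Riemann form `e_D` of an ample divisor is
replaced by the polarization pairing `Q_h(x, y) = h^{dim A - 1} ⌣ x ⌣ y` on `H¹`
(`Motives.polarizationPairingOne A.X h (A.dim - 1)`, values in `H^{2 dim A}(A(ℂ); ℂ) ≅ ℂ`), `h` the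
class of `D`: `Q_h` is a non-zero multiple of the form `e_D^*` dual to `e_D` (module docstring (3) of
`Motives/HyperbolicWeilType`, Birkenhake–Lange Lemma 1.1.17 / 1.7.4), and for `γ ∈ GL(V)`,
`u = (γ^∨)⁻¹`: `γ` commutes with `V(φ)` iff `u` commutes with `φ^* = V(φ)^∨`; `e_D(γx, γy) = c · e_D(x, y)`
iff `Q_h(u ξ, u η) = c · Q_h(ξ, η)` (`e_D` non-degenerate identifies `V ≅ V^∨` carrying `γ` to
`(γ†)^{∨}`…; elementary). Milne's condition "`γ†γ = 1`" (resp. "`∈ R^×`") is rendered, as in his own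
proof of Thm. 4.4 ("`e_D(γx, γy) = γ†γ · e_D(x, y)`"), by "`γ` preserves the form" (resp. "multiplies
it by a unit"), which is equivalent for non-degenerate `e_D` and needs no adjoint.

* `centralizerAlgebra A` — **`C(A) ⊗ ℂ` read on `H¹`**: the centraliser (Mathlib
  `Subalgebra.centralizer`) in `End_ℂ H¹(A(ℂ); ℂ)` of the pull-backs `φ^*`, `φ ∈ End(A)`; equivalently
  (`centralizerAlgebra_eq_centralizer_span`) of their `ℂ`-span, the image of `End⁰(A) ⊗ ℂ`.
* `centralizerGroup A` — `(C(A) ⊗ ℂ)^× ∩ GL(H¹)`: automorphisms `u` with `u ∘ φ^* = φ^* ∘ u` for all `φ`.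
* `unitaryCentralizerGroup A h` — **`S(A)(ℂ)`** (for the polarization class `h`): `u ∈ centralizerGroup A`
  with `Q_h(u x, u y) = Q_h(x, y)`.
* `similitudeCentralizerGroup A h` — **`G(A)(ℂ)`**: `u ∈ centralizerGroup A` with
  `Q_h(u x, u y) = c · Q_h(x, y)` for some `c ∈ ℂ^×` (the multiplier `γ†γ = l(γ, c)`).

PROVED (no hypotheses beyond those displayed):
* `S ≤ G ≤ C^×`; the multiplier is unique as soon as `Q_h ≠ 0` (`multiplier_unique`); the scalars
  `c · id` lie in `G(A)(ℂ)` with multiplier `c²` (`smulOfUnit_mem_similitudeCentralizerGroup`; Milne's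
  "`a ↦ (a⁻¹, a⁻²)` takes values in `L(A)`"); `S(A, c h) = S(A, h)`, `G(A, c h) = G(A, h)` for `c ≠ 0`.
* **`Hg′(A)(ℂ)|_{H¹} ≤ S(A)(ℂ)` and `Hg(A)(ℂ)|_{H¹} ≤ G(A)(ℂ)`** — "and so `L(A) ⊃ Hg(A)`" (p. 660) with
  Thm. 4.4, on `H¹` and WITHOUT the theorem: an element of the Hodge group commutes with every `φ^*`
  (`hodgeGroup_apply_map`, the graph class being a Hodge class) and preserves `Q_h` for every
  `h ∈ B¹(A) ⊗ ℂ` (`HodgeGroupExterior.kunneth_polarizationPairingOne`); the Mumford–Tate group is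
  `w(ℂˣ) · Hg′` (`hodgeGroupOne_le_unitaryCentralizerGroup`,
  `mumfordTateGroup_apply_one_mem_similitudeCentralizerGroup`).
* **Remark 1.2 granted Riemann's theorem** (`centralizer_centralizerAlgebra_eq_span_of_riemann`): under
  the tree's record `HodgeTheory.DeligneMilne1982_Thm_6_20_full` (the displayed binder `hR` of the
  ladder's stage 2), the centraliser of `C(A) ⊗ ℂ` in `End_ℂ H¹(A(ℂ); ℂ)` is EXACTLY the `ℂ`-span of the
  `φ^*` (`= End⁰(A) ⊗ ℂ` acting): `⊇` is tautological, `⊆` because `Hg′(A)(ℂ)|_{H¹} ⊆ C(A)^×` and the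
  commutant of the Hodge group on `H¹` is `End⁰(A) ⊗ ℂ` (Deligne I Prop. 3.4 + Riemann, the tree's
  `Deligne1982.mem_span_complexBetti_map_of_commute_hodgeGroup_of_riemann`). (Milne derives it instead
  from the semisimplicity of `End⁰(A)`, the double centraliser theorem.)

ONE named fact (D-0014/D-0026: a CITE record, net debt +1; the tree has no Néron–Severi ↔
Rosati-symmetric-endomorphism dictionary `NS(A^r) ⊗ ℚ ≅ End⁰(A^r)^{sym}` (Mumford §20–21), so neither
inclusion of Thm. 4.4 is provable on the carriers today — `lean search 'neronSeveri|rosati.*symm'`, ∅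
for abelian varieties):
* `Milne1999_thm44_specialLefschetzGroup_one_eq_unitaryCentralizerGroup` — **Theorem 4.4 with p. 659
  ("the kernel of `l(A)` […] equals `S(A)`")**, on `ℂ`-points and read on `H¹`: for every complex
  abelian variety `A` and every polarization class `h` (a rational class with `s · h` Kähler for some
  real `s > 0`, i.e. a positive rational multiple of the class of an ample divisor), the degree-`1`
  components `{g₁ | g ∈ specialLefschetzGroup (dim A) A.X}` of the tree's special Lefschetz group (the
  Künneth families FIXING all Lefschetz classes on all powers, `LefschetzGroup.lean`) form exactly
  `S(A)(ℂ) = unitaryCentralizerGroup A h`. See "Identification" below for what a reviewer must accept.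
  Consequences PROVED from the record: `S(A)(ℂ)` does not depend on the polarization
  (`unitaryCentralizerGroup_eq_of_thm44`, Milne p. 643/644), and Prop. 4.8 (c) on `H¹`
  (`hodgeGroupOne_eq_unitaryCentralizerGroup_of_thm44`).

## Identification with the printed statement (what a reviewer must accept; not formalised)

(1) `C(A)`: Milne's `C(A) = End_{End⁰(A) ⊗ k}(V(A))`, `k = ℚ` for Betti cohomology; centralisers commute
with flat base change, so `C(A) ⊗_ℚ ℂ` is the centraliser of `End⁰(A) ⊗ ℂ` in `End_ℂ(V_ℂ)`, which the
anti-isomorphism `β ↦ β^∨ : End(V_ℂ) → End(V_ℂ^∨) = End_ℂ H¹(A(ℂ); ℂ)` carries onto the centraliser of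
`{V(φ)^∨ = φ^*}` = `centralizerAlgebra A` (and `End⁰(A) ⊗ ℂ → End H¹` is spanned by the `φ^*`,
`φ ∈ End A`). (2) `S(A)(ℂ)`, `G(A)(ℂ)`: by the dictionary `γ ↦ (γ^∨)⁻¹` above, with `e_D` replaced by
`Q_h ∝ e_D^*` (`h = cl(D)`; a positive rational multiple of an ample class has a multiple which IS
ample, `e_{ND} = N e_D`, same groups). (3) The record: `LefschetzGroup.lean` ("Identification" (i)–(ii),
resting on Milne Cor. 5.6 "the graph of any regular map of abelian varieties is Lefschetz") identifies
`specialLefschetzGroup (dim A) A.X` with `S(A)(ℂ) = ker l(A)(ℂ)` (Thm. 4.4, p. 659) acting diagonally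
on `⊕ₖ Hᵏ ⊗ ℂ` by `g_k = ⋀ᵏ g₁`, `g₁ = (γ^∨)⁻¹`; projecting to `k = 1` gives exactly the statement
recorded. Only `ℂ`-points occur.

## What is NOT here

* Thm. 4.4 / Cor. 4.5 as theorems (cited: the record above and `LefschetzGroup`'s
  `Milne1999_specialLefschetzGroup_invariants_le`); Prop. 1.1 / 1.5 / Cor. 4.7 (product over the simple
  isogeny factors), Prop. 1.3 (forms `ψ` with `ψ ∘ (γ × 1) = ψ ∘ (1 × γ†)` are combinations of the
  `e_D`), reductivity, the §2 case-by-case computation of `C(A)`, `S(A)` (types I–IV), §5.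
* The CM specialisation (Milne 1999b Prop. 2.5: `L(A_Ψ)(ℚ) = {α ∈ E^× | α · ια ∈ ℚ^×}`,
  `S = {α · ια = 1}`) is the theorems-only sequel `Milne1999/LefschetzCentraliserCM`.
* No algebraic groups, no `ℚ`-structure on the groups (Mathlib has neither Mumford–Tate groups nor
  abelian varieties; the tree's convention is `ℂ`-points throughout, `HodgeTheory/MotivatedGaloisGroup`).

## References

* [Milne1999LefschetzClasses] J. S. Milne, Lefschetz classes on abelian varieties, Duke Math. J. 96
  (1999) 639–675: §1 (pp. 642–644: `C(A)`, Remark 1.2, `S(A)`), §4 (p. 659: `G(A)`, Thm. 4.4, `l(A)`,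
  `w`; p. 660: `L(A) ⊃ Hg(A)`, Prop. 4.8), Cor. 5.6 (p. 663).
* [Milne1999] J. S. Milne, Lefschetz motives and the Tate conjecture, Compositio Math. 117 (1999)
  47–81: §1 p. 52 (`C(A)`, `†`, `L(A)(R) = {(γ, c) | γ†γ = c}`, `l(A)`).
* [Deligne1982HodgeCycles] P. Deligne, Hodge cycles on abelian varieties, LNM 900 (1982), I §3 Prop. 3.4,
  I §5 Prop. 5.1 (proof).
* [DeligneMilne1982Tannakian] P. Deligne, J. S. Milne, Tannakian categories, LNM 900 (1982), II Thm. 6.20.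
* [vanGeemen1994HodgeAV] B. van Geemen, An introduction to the Hodge conjecture for abelian varieties,
  LNM 1594 (1994), 6.5 (`G ⊂ Sp(E)`), 6.9 (`U_H = R ∩ Sp(E)`).
* [LangeBirkenhake1992] Ch. Birkenhake, H. Lange, Complex Abelian Varieties (1992), Lemma 1.1.17, §5.1.
-/

noncomputable section

open CategoryTheory
open Literature.AlgebraicTopology.SingularHomology
open Literature.AlgebraicGeometry.HodgeTheory
open Literature.AlgebraicGeometry.Motives
open Literature.AlgebraicGeometry.VanGeemen1994 (pullbackOne hodgeGroupOne mem_hodgeGroupOne_iff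
  hodgeClassSpan)

namespace Literature.AlgebraicGeometry.Milne1999

/-! ### `C(A) ⊗ ℂ` on `H¹`: the centraliser of the endomorphisms -/

section Centralizer

variable (A : AbelianVariety ℂ)

/-- **Milne's `C(A)`, complexified and read on `H¹(A(ℂ); ℂ)`**: "we define `C(A)` to be the
centralizer of `End⁰(A)` in `End_k(V(A))`" (§1, p. 642), `V(A) = H₁ = (H¹)^∨`, `k = ℚ` for Betti
cohomology; here the centraliser, in `End_ℂ H¹(A(ℂ); ℂ)`, of the pull-backs `φ^*`, `φ ∈ End(A)` (the
transposes of the `V(φ)`; module docstring, "Identification" (1)). A `ℂ`-subalgebra.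
[cite: Milne1999LefschetzClasses, §1 p. 642 (definition of C(A))] [cite: Milne1999, §1 p. 52] -/
def centralizerAlgebra : Subalgebra ℂ (Module.End ℂ (complexBetti A.X 1)) :=
  Subalgebra.centralizer ℂ (Set.range fun φ : A ⟶ A ↦ pullbackOne A φ)

variable {A}

/-- Membership in `C(A) ⊗ ℂ`: `T` commutes with every `φ^*`. [cite: Milne1999LefschetzClasses, §1 p. 642] -/
theorem mem_centralizerAlgebra_iff {T : Module.End ℂ (complexBetti A.X 1)} :
    T ∈ centralizerAlgebra A ↔ ∀ φ : A ⟶ A, pullbackOne A φ * T = T * pullbackOne A φ := by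
  simp only [centralizerAlgebra, Subalgebra.mem_centralizer_iff, Set.forall_mem_range]

/-- Membership in `C(A) ⊗ ℂ`, pointwise: `T (φ^* x) = φ^* (T x)`. [cite: Milne1999LefschetzClasses, §1 p. 642] -/
theorem mem_centralizerAlgebra_iff' {T : Module.End ℂ (complexBetti A.X 1)} :
    T ∈ centralizerAlgebra A ↔
      ∀ (φ : A ⟶ A) (x : complexBetti A.X 1), T (pullbackOne A φ x) = pullbackOne A φ (T x) := by
  rw [mem_centralizerAlgebra_iff]
  refine forall_congr' fun φ ↦ ⟨fun h x ↦ ?_, fun h ↦ LinearMap.ext fun x ↦ ?_⟩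
  · have e := LinearMap.congr_fun h x
    rw [Module.End.mul_apply, Module.End.mul_apply] at e
    exact e.symm
  · rw [Module.End.mul_apply, Module.End.mul_apply, h x]

/-- **`C(A) ⊗ ℂ` is the centraliser of `End⁰(A) ⊗ ℂ`** (acting on `H¹` through the `ℂ`-span of the
`φ^*`): centralising the `φ^*` is the same as centralising their `ℂ`-linear combinations.
[cite: Milne1999LefschetzClasses, §1 p. 642 (`C(A) = End_{End⁰(A) ⊗ k}(V(A))`) and Remark 1.6] -/
theorem centralizerAlgebra_eq_centralizer_span :
    centralizerAlgebra A = Subalgebra.centralizer ℂ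
      (Submodule.span ℂ (Set.range fun φ : A ⟶ A ↦ pullbackOne A φ) :
        Set (Module.End ℂ (complexBetti A.X 1))) := by
  refine le_antisymm (fun T hT ↦ ?_) (Subalgebra.centralizer_le ℂ _ _ Submodule.subset_span)
  rw [Subalgebra.mem_centralizer_iff]
  intro g hg
  induction hg using Submodule.span_induction with
  | mem x hx => exact (Subalgebra.mem_centralizer_iff ℂ).1 hT x hx
  | zero => rw [zero_mul, mul_zero]
  | add x y _ _ hx hy => rw [add_mul, mul_add, hx, hy]
  | smul a x _ hx => rw [smul_mul_assoc, mul_smul_comm, hx]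

/-- Every pull-back `ψ^*` commutes with `C(A) ⊗ ℂ` (tautologically: `C(A)` centralises the `ψ^*`), i.e.
lies in the centraliser of `C(A) ⊗ ℂ` — the inclusion "`End⁰(A) ⊗ k ⊆` centralizer of `C(A)`" of
Remark 1.2. [cite: Milne1999LefschetzClasses, §1 Remark 1.2 (p. 643)] -/
theorem pullbackOne_mem_centralizer_centralizerAlgebra (ψ : A ⟶ A) :
    pullbackOne A ψ ∈ Subalgebra.centralizer ℂ
      (centralizerAlgebra A : Set (Module.End ℂ (complexBetti A.X 1))) := by
  rw [Subalgebra.mem_centralizer_iff]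
  intro T hT
  exact ((mem_centralizerAlgebra_iff.1 hT) ψ).symm

variable (A)

/-- **`(C(A) ⊗ ℂ)^×` inside `GL(H¹(A(ℂ); ℂ))`**: the automorphisms `u` of `H¹(A(ℂ); ℂ)` commuting with
every `φ^*`, `φ ∈ End(A)` ("whose elements commute with the endomorphisms of `A`", p. 644) — the
ambient group of `S(A)(ℂ) ⊆ G(A)(ℂ)`. [cite: Milne1999LefschetzClasses, §1 pp. 642–644] -/
def centralizerGroup : Subgroup (complexBetti A.X 1 ≃ₗ[ℂ] complexBetti A.X 1) where
  carrier := {u | ∀ (φ : A ⟶ A) (x : complexBetti A.X 1), u (pullbackOne A φ x) = pullbackOne A φ (u x)}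
  mul_mem' := by
    intro u v hu hv φ x
    rw [LinearEquiv.mul_apply, LinearEquiv.mul_apply, hv, hu]
  one_mem' := fun _ _ ↦ rfl
  inv_mem' := by
    intro u hu φ x
    rw [LinearEquiv.coe_inv, LinearEquiv.symm_apply_eq, hu, LinearEquiv.apply_symm_apply]

/-- **`S(A)(ℂ)`** — "`S(A)(R) = {γ ∈ C(A) ⊗_k R | γ†γ = 1}` […] for any ample divisor `D` on `A`, `S(A)` is
the largest algebraic subgroup of `Sp(e_D)` whose elements commute with the endomorphisms of `A`"
(§1, p. 644), on `ℂ`-points and read on `H¹(A(ℂ); ℂ)` for the polarization CLASS `h ∈ H²(A(ℂ); ℂ)`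
(intended: the class of an ample divisor, or a positive rational multiple): the automorphisms
commuting with every `φ^*` and preserving the polarization pairing
`Q_h(x, y) = h^{dim A - 1} ⌣ x ⌣ y` (`Motives.polarizationPairingOne`, `∝` the form dual to `e_D`).
`= ker l(A)(ℂ)` by Thm. 4.4 (record `Milne1999_thm44_specialLefschetzGroup_one_eq_unitaryCentralizerGroup`).
[cite: Milne1999LefschetzClasses, §1 p. 644 (definition of S(A)) and §4 p. 659] -/
def unitaryCentralizerGroup (h : complexBetti A.X 2) :
    Subgroup (complexBetti A.X 1 ≃ₗ[ℂ] complexBetti A.X 1) where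
  carrier := {u | u ∈ centralizerGroup A ∧ ∀ x y : complexBetti A.X 1,
    polarizationPairingOne A.X h (A.dim - 1) (u x) (u y) = polarizationPairingOne A.X h (A.dim - 1) x y}
  mul_mem' := by
    rintro u v ⟨hu, hu'⟩ ⟨hv, hv'⟩
    refine ⟨(centralizerGroup A).mul_mem hu hv, fun x y ↦ ?_⟩
    rw [LinearEquiv.mul_apply, LinearEquiv.mul_apply, hu', hv']
  one_mem' := ⟨(centralizerGroup A).one_mem, fun _ _ ↦ rfl⟩
  inv_mem' := by
    rintro u ⟨hu, hu'⟩
    refine ⟨(centralizerGroup A).inv_mem hu, fun x y ↦ ?_⟩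
    rw [← hu' (u⁻¹ x) (u⁻¹ y), LinearEquiv.coe_inv, LinearEquiv.apply_symm_apply,
      LinearEquiv.apply_symm_apply]

/-- **`G(A)(ℂ)`** — "Let `G(A)` be the algebraic subgroup of `GL(V(A))` such that
`G(A)(R) = {γ ∈ C(A) ⊗ R | γ†γ ∈ R^×}` […] for any ample divisor `D` on `A`, `G(A)` is the largest
algebraic subgroup of `GSp(E^D)` commuting with the endomorphisms of `A`" (§4, p. 659; Compositio 117
p. 52: `L(A)(R) = {(γ, c) ∈ (C(A) ⊗ R)^× × R^× | γ†γ = c}`), on `ℂ`-points and read on `H¹`: the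
automorphisms commuting with every `φ^*` which multiply `Q_h` by a unit `c` (the multiplier
`γ†γ = l(A)(γ, c)`; "`e_D(γx, γy) = γ†γ · e_D(x, y)`", proof of Thm. 4.4). `≅ L(A)(ℂ)` by Thm. 4.4.
[cite: Milne1999LefschetzClasses, §4 p. 659 (definition of G(A), Thm. 4.4)] [cite: Milne1999, §1 p. 52] -/
def similitudeCentralizerGroup (h : complexBetti A.X 2) :
    Subgroup (complexBetti A.X 1 ≃ₗ[ℂ] complexBetti A.X 1) where
  carrier := {u | u ∈ centralizerGroup A ∧ ∃ c : ℂˣ, ∀ x y : complexBetti A.X 1,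
    polarizationPairingOne A.X h (A.dim - 1) (u x) (u y) =
      (c : ℂ) • polarizationPairingOne A.X h (A.dim - 1) x y}
  mul_mem' := by
    rintro u v ⟨hu, c, hc⟩ ⟨hv, d, hd⟩
    refine ⟨(centralizerGroup A).mul_mem hu hv, c * d, fun x y ↦ ?_⟩
    rw [LinearEquiv.mul_apply, LinearEquiv.mul_apply, hc, hd, smul_smul, Units.val_mul]
  one_mem' := ⟨(centralizerGroup A).one_mem, 1, fun _ _ ↦ by rw [Units.val_one, one_smul]; rfl⟩
  inv_mem' := by
    rintro u ⟨hu, c, hc⟩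
    refine ⟨(centralizerGroup A).inv_mem hu, c⁻¹, fun x y ↦ ?_⟩
    have e := hc (u⁻¹ x) (u⁻¹ y)
    rw [LinearEquiv.coe_inv, LinearEquiv.apply_symm_apply, LinearEquiv.apply_symm_apply] at e
    rw [LinearEquiv.coe_inv, e, smul_smul, Units.inv_mul, one_smul]

variable {A} {h : complexBetti A.X 2} {u : complexBetti A.X 1 ≃ₗ[ℂ] complexBetti A.X 1}

/-- Membership in `(C(A) ⊗ ℂ)^×`, unfolded. [cite: Milne1999LefschetzClasses, §1 p. 642] -/
theorem mem_centralizerGroup_iff :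
    u ∈ centralizerGroup A ↔
      ∀ (φ : A ⟶ A) (x : complexBetti A.X 1), u (pullbackOne A φ x) = pullbackOne A φ (u x) :=
  Iff.rfl

/-- `u ∈ (C(A) ⊗ ℂ)^×` iff the underlying endomorphism lies in `C(A) ⊗ ℂ`. [cite: Milne1999LefschetzClasses, §1 p. 642] -/
theorem mem_centralizerGroup_iff_coe_mem :
    u ∈ centralizerGroup A ↔ (u : Module.End ℂ (complexBetti A.X 1)) ∈ centralizerAlgebra A := by
  rw [mem_centralizerGroup_iff, mem_centralizerAlgebra_iff']
  rfl

/-- Membership in `S(A)(ℂ)`, unfolded. [cite: Milne1999LefschetzClasses, §1 p. 644] -/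
theorem mem_unitaryCentralizerGroup_iff :
    u ∈ unitaryCentralizerGroup A h ↔ u ∈ centralizerGroup A ∧ ∀ x y : complexBetti A.X 1,
      polarizationPairingOne A.X h (A.dim - 1) (u x) (u y) = polarizationPairingOne A.X h (A.dim - 1) x y :=
  Iff.rfl

/-- Membership in `G(A)(ℂ)`, unfolded. [cite: Milne1999LefschetzClasses, §4 p. 659] -/
theorem mem_similitudeCentralizerGroup_iff :
    u ∈ similitudeCentralizerGroup A h ↔ u ∈ centralizerGroup A ∧ ∃ c : ℂˣ, ∀ x y : complexBetti A.X 1,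
      polarizationPairingOne A.X h (A.dim - 1) (u x) (u y) =
        (c : ℂ) • polarizationPairingOne A.X h (A.dim - 1) x y :=
  Iff.rfl

/-- `S(A) ≤ C(A)^×`. [cite: Milne1999LefschetzClasses, §1 p. 644] -/
theorem unitaryCentralizerGroup_le_centralizerGroup : unitaryCentralizerGroup A h ≤ centralizerGroup A :=
  fun _ hu ↦ hu.1

/-- `G(A) ≤ C(A)^×`. [cite: Milne1999LefschetzClasses, §4 p. 659] -/
theorem similitudeCentralizerGroup_le_centralizerGroup :
    similitudeCentralizerGroup A h ≤ centralizerGroup A :=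
  fun _ hu ↦ hu.1

/-- **`S(A) ≤ G(A)`** (multiplier `1`; `S(A) = ker l(A)`, p. 659). [cite: Milne1999LefschetzClasses, §4 p. 659] -/
theorem unitaryCentralizerGroup_le_similitudeCentralizerGroup :
    unitaryCentralizerGroup A h ≤ similitudeCentralizerGroup A h :=
  fun _ hu ↦ ⟨hu.1, 1, fun x y ↦ by rw [Units.val_one, one_smul]; exact hu.2 x y⟩

/-- `S(A)(ℂ) = {u ∈ G(A)(ℂ) | multiplier 1}` ("the kernel of `l(A)` […] equals `S(A)`", in the
direction that is definitional here). [cite: Milne1999LefschetzClasses, §4 p. 659] -/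
theorem mem_unitaryCentralizerGroup_iff_mem_similitudeCentralizerGroup :
    u ∈ unitaryCentralizerGroup A h ↔ u ∈ similitudeCentralizerGroup A h ∧ ∀ x y : complexBetti A.X 1,
      polarizationPairingOne A.X h (A.dim - 1) (u x) (u y) = polarizationPairingOne A.X h (A.dim - 1) x y :=
  ⟨fun hu ↦ ⟨unitaryCentralizerGroup_le_similitudeCentralizerGroup hu, hu.2⟩, fun hu ↦ ⟨hu.1.1, hu.2⟩⟩

/-- **The multiplier `l(A)(γ) = γ†γ` is well defined** as soon as the pairing `Q_h` is not identically
zero: two units `c, d` with `Q_h(u x, u y) = c · Q_h(x, y) = d · Q_h(x, y)` coincide.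
[cite: Milne1999LefschetzClasses, §4 p. 659 (the cocharacter l(A))] -/
theorem multiplier_unique {c d : ℂˣ}
    (hc : ∀ x y : complexBetti A.X 1, polarizationPairingOne A.X h (A.dim - 1) (u x) (u y) =
      (c : ℂ) • polarizationPairingOne A.X h (A.dim - 1) x y)
    (hd : ∀ x y : complexBetti A.X 1, polarizationPairingOne A.X h (A.dim - 1) (u x) (u y) =
      (d : ℂ) • polarizationPairingOne A.X h (A.dim - 1) x y)
    (hQ : ∃ x y : complexBetti A.X 1, polarizationPairingOne A.X h (A.dim - 1) x y ≠ 0) : c = d := by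
  obtain ⟨x, y, hxy⟩ := hQ
  have e : ((c : ℂ) - d) • polarizationPairingOne A.X h (A.dim - 1) x y = 0 := by
    rw [sub_smul, ← hc x y, ← hd x y, sub_self]
  rcases smul_eq_zero.1 e with e | e
  · exact Units.val_injective (sub_eq_zero.1 e)
  · exact absurd e hxy

/-- The scalar automorphism `c · id` of `H¹(A(ℂ); ℂ)` (`LinearEquiv.smulOfUnit`), evaluated. [folklore] -/
private theorem smulOfUnit_apply' (c : ℂˣ) (x : complexBetti A.X 1) :
    LinearEquiv.smulOfUnit c x = (c : ℂ) • x := by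
  simp [LinearEquiv.smulOfUnit, Units.smul_def]

variable (A h) in
/-- **The scalars lie in `G(A)(ℂ)`**: `c · id` commutes with every `φ^*` and multiplies `Q_h` by `c²`
(Milne p. 659: "the homomorphism `a ↦ (a⁻¹, a⁻²) : 𝔾_m → GL(V(A)) × 𝔾_m` takes values in `L(A)`.
Therefore `L(A)` has a canonical cocharacter `w`"; on `H¹ = V^∨`, `a⁻¹ ↦ a`).
[cite: Milne1999LefschetzClasses, §4 p. 659 (the cocharacter w, l ∘ w = -2)] -/
theorem smulOfUnit_mem_similitudeCentralizerGroup (c : ℂˣ) :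
    LinearEquiv.smulOfUnit c ∈ similitudeCentralizerGroup A h := by
  refine ⟨fun φ x ↦ ?_, c * c, fun x y ↦ ?_⟩
  · rw [smulOfUnit_apply', smulOfUnit_apply', map_smul]
  · rw [smulOfUnit_apply', smulOfUnit_apply', map_smul, map_smul, LinearMap.smul_apply, smul_smul,
      Units.val_mul]

/-- Rescaling the polarization class does not change `S(A)(ℂ)` (`Q_{c h} = c^{dim A - 1} Q_h`; a
polarization class matters up to `ℚ^×_{>0}` only). [cite: Milne1999LefschetzClasses, §1 p. 643 (independence of the ample divisor)] -/
theorem unitaryCentralizerGroup_smul {c : ℂ} (hc : c ≠ 0) (h : complexBetti A.X 2) :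
    unitaryCentralizerGroup A (c • h) = unitaryCentralizerGroup A h := by
  ext u
  simp only [mem_unitaryCentralizerGroup_iff, polarizationPairingOne_smul]
  exact and_congr_right fun _ ↦ forall_congr' fun x ↦ forall_congr' fun y ↦
    (smul_right_injective _ (pow_ne_zero _ hc)).eq_iff

/-- Rescaling the polarization class does not change `G(A)(ℂ)`. [cite: Milne1999LefschetzClasses, §1 p. 643 and §4 p. 659] -/
theorem similitudeCentralizerGroup_smul {c : ℂ} (hc : c ≠ 0) (h : complexBetti A.X 2) :
    similitudeCentralizerGroup A (c • h) = similitudeCentralizerGroup A h := by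
  ext u
  simp only [mem_similitudeCentralizerGroup_iff, polarizationPairingOne_smul]
  refine and_congr_right fun _ ↦ exists_congr fun d ↦ forall_congr' fun x ↦ forall_congr' fun y ↦ ?_
  rw [smul_comm (d : ℂ) (c ^ (A.dim - 1))]
  exact (smul_right_injective _ (pow_ne_zero _ hc)).eq_iff

end Centralizer

/-! ### The Hodge group: `Hg′(A)(ℂ)|_{H¹} ≤ S(A)(ℂ)`, `Hg(A)(ℂ)|_{H¹} ≤ G(A)(ℂ)` ("`L(A) ⊃ Hg(A)`") -/

section Hodge

variable {A : AbelianVariety ℂ} {h : complexBetti A.X 2}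

/-- **`Hg′(A)(ℂ)|_{H¹} ≤ (C(A) ⊗ ℂ)^×`**: the Hodge group commutes with every `φ^*`, `φ ∈ End(A)` (the
graph class of `φ` is a Hodge class; the tree's `hodgeGroup_apply_map`, Deligne I Prop. 3.4 / Voisin I
Lemma 11.41) — the first half of "`L(A) ⊃ Hg(A)`" read through Thm. 4.4.
[cite: Milne1999LefschetzClasses, §4 p. 660 (`L(A) ⊃ Hg(A)`)] [cite: Deligne1982HodgeCycles, I §3 Prop. 3.4] -/
theorem hodgeGroupOne_le_centralizerGroup : hodgeGroupOne A.dim A.X ≤ centralizerGroup A := by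
  intro u hu
  obtain ⟨g, hg, rfl⟩ := mem_hodgeGroupOne_iff.1 hu
  exact fun φ x ↦ hodgeGroup_apply_map AbelianVariety.isSmoothProjective_holds hg φ.hom.hom.hom 1 x

/-- **`Hg′(A)(ℂ)|_{H¹} ≤ S(A)(ℂ)`** — "Clearly `D_hom(A) ⊂ H(A)`, and so `L(A) ⊃ Hg(A)`" (p. 660) together
with "the kernel of `l(A)` […] equals `S(A)`" (p. 659), PROVED on `H¹` without Thm. 4.4, for every
`h ∈ B¹(A) ⊗ ℂ` (`VanGeemen1994.hodgeClassSpan A.dim A.X 1`, e.g. a polarization class): an element of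
the Hodge group commutes with the `φ^*` and preserves `Q_h` (it fixes `h` and is multiplicative and
trivial in top degree: `HodgeGroupExterior.kunneth_polarizationPairingOne`; van Geemen 6.5 "`G ⊂ Sp(E)`").
[cite: Milne1999LefschetzClasses, §4 pp. 659–660] [cite: vanGeemen1994HodgeAV, 6.5] -/
theorem hodgeGroupOne_le_unitaryCentralizerGroup (hh : h ∈ hodgeClassSpan A.dim A.X 1) :
    hodgeGroupOne A.dim A.X ≤ unitaryCentralizerGroup A h := by
  intro u hu
  refine ⟨hodgeGroupOne_le_centralizerGroup hu, ?_⟩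
  obtain ⟨g, hg, rfl⟩ := mem_hodgeGroupOne_iff.1 hu
  obtain ⟨G, hG, h0, hfix⟩ := hg
  have hg' : g ∈ hodgeGroup A.dim A.X := ⟨G, hG, h0, hfix⟩
  have hh2 : g 2 h = h := VanGeemen1994.apply_eq_self_of_mem_hodgeClassSpan hg' (p := 1) hh
  exact fun x y ↦ HodgeGroupExterior.kunneth_polarizationPairingOne hG h0 rfl hfix hh2 (by omega) x y

/-- `Hg′(A)(ℂ)|_{H¹} ≤ S(A)(ℂ)` for `h` a RATIONAL class of Hodge type `(1,1)` (a divisor class, by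
Lefschetz `(1,1)`; in particular the class of an ample divisor). [cite: Milne1999LefschetzClasses, §4 pp. 659–660] -/
theorem hodgeGroupOne_le_unitaryCentralizerGroup_of_isRationalClass (hQ : IsRationalClass h)
    (h11 : IsOfHodgeType A.dim A.X 2 1 1 h) : hodgeGroupOne A.dim A.X ≤ unitaryCentralizerGroup A h :=
  hodgeGroupOne_le_unitaryCentralizerGroup (Submodule.subset_span
    (show h ∈ {c : complexBetti A.X (2 * 1) | IsRationalClass c ∧ IsOfHodgeType A.dim A.X (2 * 1) 1 1 c}
      from ⟨hQ, h11⟩))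

/-- `Hg′(A)(ℂ)|_{H¹} ≤ S(A)(ℂ)` for a polarization class in the Kähler spelling: `h` rational with `s · h`
Kähler for some real `s ≠ 0` (Kähler classes are of type `(1,1)`, `IsKaehlerClass.isOfHodgeType_one_one`).
[cite: Milne1999LefschetzClasses, §4 pp. 659–660] [cite: VoisinHodgeI2002, §7.1.2] -/
theorem hodgeGroupOne_le_unitaryCentralizerGroup_of_isKaehlerClass (hQ : IsRationalClass h) {s : ℝ}
    (hs : s ≠ 0) (hK : IsKaehlerClass A.dim A.X ((s : ℂ) • h)) :
    hodgeGroupOne A.dim A.X ≤ unitaryCentralizerGroup A h := by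
  refine hodgeGroupOne_le_unitaryCentralizerGroup_of_isRationalClass hQ ?_
  have h1 := (hK.isOfHodgeType_one_one).smul ((s : ℂ)⁻¹)
  rwa [smul_smul, inv_mul_cancel₀ (Complex.ofReal_ne_zero.2 hs), one_smul] at h1

/-- **`Hg(A)(ℂ)|_{H¹} ≤ G(A)(ℂ)`** — "`L(A) ⊃ Hg(A)`" (p. 660) in Milne's own convention (`GL × 𝔾_m`, the
tree's `mumfordTateGroup = w(ℂˣ) · hodgeGroup`), read on `H¹` through Thm. 4.4 (`L(A) ≅ G(A)`): for
`m ∈ MT(A)(ℂ)`, `m₁ = c · g₁` lies in `G(A)(ℂ)` (multiplier `c²`) for every `h ∈ B¹(A) ⊗ ℂ`.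
[cite: Milne1999LefschetzClasses, §4 pp. 659–660 (Thm. 4.4, `L(A) ⊃ Hg(A)`)] [cite: Deligne1982HodgeCycles, I §3] -/
theorem mumfordTateGroup_apply_one_mem_similitudeCentralizerGroup (hh : h ∈ hodgeClassSpan A.dim A.X 1)
    {m : ∀ k : ℕ, complexBetti A.X k ≃ₗ[ℂ] complexBetti A.X k} (hm : m ∈ mumfordTateGroup A.dim A.X) :
    m 1 ∈ similitudeCentralizerGroup A h := by
  obtain ⟨c, g, hg, rfl⟩ := mem_powClassSimilitudeGroup_iff_exists_weightCocharacter_mul.1 hm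
  have hu : g 1 ∈ unitaryCentralizerGroup A h :=
    hodgeGroupOne_le_unitaryCentralizerGroup hh (mem_hodgeGroupOne_iff.2 ⟨g, hg, rfl⟩)
  have e : (weightCocharacter A.X c * g) 1 = LinearEquiv.smulOfUnit c * g 1 := by
    change weightCocharacter A.X c 1 * g 1 = _
    rw [show weightCocharacter A.X c 1 = LinearEquiv.smulOfUnit c from by
      change LinearEquiv.smulOfUnit (c ^ 1) = _
      rw [pow_one]]
  rw [e]
  exact (similitudeCentralizerGroup A h).mul_mem (smulOfUnit_mem_similitudeCentralizerGroup A h c)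
    (unitaryCentralizerGroup_le_similitudeCentralizerGroup hu)

end Hodge

/-! ### Remark 1.2 granted Riemann's theorem: the centraliser of `C(A) ⊗ ℂ` is `End⁰(A) ⊗ ℂ` -/

section DoubleCentralizer

variable (A : AbelianVariety ℂ)

/-- **Milne 1999 Remark 1.2, on `H¹(A(ℂ); ℂ)`, GRANTED RIEMANN'S THEOREM** ("the centralizer of `C(A)` in
`End_k(V(A))` is `End⁰(A) ⊗_ℚ k`"; Milne: from the semisimplicity of `End⁰(A)`): under the tree's record
`hR = HodgeTheory.DeligneMilne1982_Thm_6_20_full` (Deligne–Milne II Thm. 6.20, the displayed binder of the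
Hodge ladder's stage 2), the centraliser of `C(A) ⊗ ℂ` in `End_ℂ H¹(A(ℂ); ℂ)` is exactly the `ℂ`-span of
the pull-backs `φ^*`, `φ ∈ End(A)` (the image of `End⁰(A) ⊗ ℂ`). `⊇`: `pullbackOne_mem_centralizer_centralizerAlgebra`.
`⊆`: an endomorphism commuting with `C(A) ⊗ ℂ` commutes with `Hg′(A)(ℂ)|_{H¹} ⊆ (C(A) ⊗ ℂ)^×`
(`hodgeGroupOne_le_centralizerGroup`), hence lies in the span of the `φ^*` by Deligne I Prop. 3.4 with
Riemann's theorem (`Deligne1982.mem_span_complexBetti_map_of_commute_hodgeGroup_of_riemann`).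
[cite: Milne1999LefschetzClasses, §1 Remark 1.2 (p. 643)] [cite: Deligne1982HodgeCycles, I §3 Prop. 3.4 and I §5 Prop. 5.1 (proof)]
[cite: DeligneMilne1982Tannakian, II Thm. 6.20] -/
theorem centralizer_centralizerAlgebra_eq_span_of_riemann (hR : DeligneMilne1982_Thm_6_20_full) :
    Subalgebra.toSubmodule (Subalgebra.centralizer ℂ
        (centralizerAlgebra A : Set (Module.End ℂ (complexBetti A.X 1)))) =
      Submodule.span ℂ (Set.range fun φ : A ⟶ A ↦ pullbackOne A φ) := by
  refine le_antisymm (fun T hT ↦ ?_) (Submodule.span_le.2 ?_)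
  · rw [Subalgebra.mem_toSubmodule, Subalgebra.mem_centralizer_iff] at hT
    refine Deligne1982.mem_span_complexBetti_map_of_commute_hodgeGroup_of_riemann hR A T fun g hg y ↦ ?_
    have hg1 : ((g 1 : complexBetti A.X 1 ≃ₗ[ℂ] complexBetti A.X 1) : Module.End ℂ (complexBetti A.X 1)) ∈
        centralizerAlgebra A :=
      mem_centralizerGroup_iff_coe_mem.1 (hodgeGroupOne_le_centralizerGroup (mem_hodgeGroupOne_iff.2 ⟨g, hg, rfl⟩))
    have e := LinearMap.congr_fun (hT _ hg1) y
    rw [Module.End.mul_apply, Module.End.mul_apply] at e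
    exact e.symm
  · rintro _ ⟨ψ, rfl⟩
    exact pullbackOne_mem_centralizer_centralizerAlgebra ψ

end DoubleCentralizer

/-! ### Theorem 4.4 on `H¹` (one cited record) and its consequences -/

section Record

/-- **Milne 1999, Theorem 4.4 with p. 659 ("the kernel of `l(A)`, regarded as a subgroup of `GL(V(A))`,
equals `S(A)`"), on `ℂ`-points and read on `H¹`.** "Theorem 4.4. The map `γ ↦ (γ, γ†γ) : G(A) →
GL(V(A)) × 𝔾_m` sends `G(A)` isomorphically onto `L(A)`"; restricted to multiplier `1`: `S(A) = ker l(A)`,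
the subgroup of `L(A)` FIXING the Lefschetz classes `D^s_hom(A^r)_k ⊂ H^{2s}(A^r)` on all powers. In the
tree's rendering (`Milne1999/LefschetzGroup`: `specialLefschetzGroup (dim A) A.X ≤ ∏ₖ GL(Hᵏ(A(ℂ); ℂ))`, the
Künneth families fixing `lefschetzPowClasses`, identified there — "Identification" (i)–(ii), via Cor. 5.6
— with `S(A)(ℂ)` acting by `g_k = ⋀ᵏ g₁`), projected to `k = 1`: for every complex abelian variety `A` and
every polarization class `h` — a RATIONAL class with `s · h` KÄHLER for some real `s > 0` (a positive
rational multiple of the class of an ample divisor; `e_{ND} = N e_D`) — the degree-one components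
`{g₁ | g ∈ specialLefschetzGroup (dim A) A.X}` form exactly `S(A)(ℂ) = unitaryCentralizerGroup A h`
(automorphisms of `H¹(A(ℂ); ℂ)` commuting with all `φ^*` and preserving `Q_h ∝ e_D^*`). Both inclusions
are cite-grade on the carriers: `⊇` is Milne's "`e_D(γx, γy) = γ†γ · e_D(x, y)` […] `(γ, γ†γ)` fixes
`e_D`. It therefore fixes the class of `D` […] any `γ ∈ G(A)(k^al)` will fix all divisor classes on
`A^r`, all `r`" (needs `NS(A^r) ⊗ ℚ ≅` the `e_{D₀}`-symmetric part of `End⁰(A^r)`, Mumford §20–21, absent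
from the tree); `⊆` is "Theorem 3.2 [invariant theory of `S(A)`] […] and a variant of Chevalley's theorem".
STATUS (2026-08-21): this statement is now PROVED in the tree —
`Milne1999_thm44_specialLefschetzGroup_one_eq_unitaryCentralizerGroup_holds` of
`Milne1999/SpecialLefschetzGroupOneEqUnitaryCentralizer` (`⊆`: `LefschetzGroupCentraliserInclusion`, from the
degree-`2` Lefschetz classes of `A × A`; `⊇`: the Künneth family `⋀•(u ⊕ ⋯ ⊕ u)` on the powers, with
`CentraliserFixesDivisorClasses` applied to `A^{a+1}` and the blockwise non-degeneracy of `Q_{Σ prᵢ^* h}` in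
place of the Néron–Severi dictionary); the record is kept as the named statement its consumers take as a
hypothesis (feed them `…_holds`).
[cite: Milne1999LefschetzClasses, Thm. 4.4 and p. 659 (ker l(A) = S(A)), Cor. 5.6 (p. 663)]
[cite: Milne1999, §1 p. 52 (`L(A)(R) = {(γ, c) | γ†γ = c}`)] -/
def Milne1999_thm44_specialLefschetzGroup_one_eq_unitaryCentralizerGroup : Prop :=
  ∀ (A : AbelianVariety ℂ) (h : complexBetti A.X 2), IsRationalClass h →
    (∃ s : ℝ, 0 < s ∧ IsKaehlerClass A.dim A.X ((s : ℂ) • h)) →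
      (specialLefschetzGroup A.dim A.X).map
          (Pi.evalMonoidHom (fun k : ℕ ↦ complexBetti A.X k ≃ₗ[ℂ] complexBetti A.X k) 1) =
        unitaryCentralizerGroup A h

variable {A : AbelianVariety ℂ} {h h' : complexBetti A.X 2}

/-- Under the record: **`g₁ ∈ S(A)(ℂ)` for every `g` in the special Lefschetz group** (Milne's
`G(A) ⊂ L(A)` direction read backwards on `ℂ`-points: the elements of `ker l(A)` ARE the `(γ, 1)`,
`γ ∈ S(A)`). [cite: Milne1999LefschetzClasses, Thm. 4.4 and p. 659] -/
theorem apply_one_mem_unitaryCentralizerGroup_of_thm44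
    (hrec : Milne1999_thm44_specialLefschetzGroup_one_eq_unitaryCentralizerGroup) (hQ : IsRationalClass h)
    (hK : ∃ s : ℝ, 0 < s ∧ IsKaehlerClass A.dim A.X ((s : ℂ) • h))
    {g : ∀ k : ℕ, complexBetti A.X k ≃ₗ[ℂ] complexBetti A.X k} (hg : g ∈ specialLefschetzGroup A.dim A.X) :
    g 1 ∈ unitaryCentralizerGroup A h := by
  rw [← hrec A h hQ hK]
  exact Subgroup.mem_map.2 ⟨g, hg, rfl⟩

/-- Under the record: **every element of `S(A)(ℂ)` is the degree-one component of a Künneth family fixing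
all Lefschetz classes on all powers of `A`** (Milne's "any `γ ∈ G(A)(k^al)` will fix all divisor classes
on `A^r`, all `r`. This shows that `G(A) ⊂ L(A)`"). [cite: Milne1999LefschetzClasses, Thm. 4.4 (proof, first half)] -/
theorem exists_mem_specialLefschetzGroup_of_thm44
    (hrec : Milne1999_thm44_specialLefschetzGroup_one_eq_unitaryCentralizerGroup) (hQ : IsRationalClass h)
    (hK : ∃ s : ℝ, 0 < s ∧ IsKaehlerClass A.dim A.X ((s : ℂ) • h))
    {u : complexBetti A.X 1 ≃ₗ[ℂ] complexBetti A.X 1} (hu : u ∈ unitaryCentralizerGroup A h) :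
    ∃ g ∈ specialLefschetzGroup A.dim A.X, g 1 = u := by
  rw [← hrec A h hQ hK] at hu
  obtain ⟨g, hg, hgu⟩ := Subgroup.mem_map.1 hu
  exact ⟨g, hg, hgu⟩

/-- Under the record: **`S(A)(ℂ)` does not depend on the polarization** ("the restriction of `†` to `C(A)`
is independent of the choice of `D`", p. 643; "Clearly `S(A)` depends only on the isogeny class of `A`",
p. 644): two polarization classes give the same subgroup of `GL(H¹(A(ℂ); ℂ))`.
[cite: Milne1999LefschetzClasses, §1 pp. 643–644] -/
theorem unitaryCentralizerGroup_eq_of_thm44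
    (hrec : Milne1999_thm44_specialLefschetzGroup_one_eq_unitaryCentralizerGroup)
    (hQ : IsRationalClass h) (hK : ∃ s : ℝ, 0 < s ∧ IsKaehlerClass A.dim A.X ((s : ℂ) • h))
    (hQ' : IsRationalClass h') (hK' : ∃ s : ℝ, 0 < s ∧ IsKaehlerClass A.dim A.X ((s : ℂ) • h')) :
    unitaryCentralizerGroup A h = unitaryCentralizerGroup A h' := by
  rw [← hrec A h hQ hK, ← hrec A h' hQ' hK']

/-- Under the record: **Milne Prop. 4.8 (c) `Hg′(A) = S(A)`, read on `H¹`** — if the tree's Hodge group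
equals the special Lefschetz group (condition (c) in the stabiliser rendering of `LefschetzGroup.lean`,
e.g. from (a) "no power of `A` supports an exotic Hodge class",
`AbelianVariety.hodgeGroup_eq_specialLefschetzGroup_of_forall_isDivisorGenerated`), then
`Hg′(A)(ℂ)|_{H¹} = S(A)(ℂ)` as subgroups of `GL(H¹(A(ℂ); ℂ))`. [cite: Milne1999LefschetzClasses, Prop. 4.8 (p. 660) and Thm. 4.4] -/
theorem hodgeGroupOne_eq_unitaryCentralizerGroup_of_thm44
    (hrec : Milne1999_thm44_specialLefschetzGroup_one_eq_unitaryCentralizerGroup)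
    (hQ : IsRationalClass h) (hK : ∃ s : ℝ, 0 < s ∧ IsKaehlerClass A.dim A.X ((s : ℂ) • h))
    (hc : hodgeGroup A.dim A.X = specialLefschetzGroup A.dim A.X) :
    hodgeGroupOne A.dim A.X = unitaryCentralizerGroup A h := by
  rw [← hrec A h hQ hK, ← hc]
  rfl

/-- Under the record, for an abelian variety with NO EXOTIC HODGE CLASS ON ANY POWER
(`IsDivisorGenerated (A.powSucc a)` for all `a`, Milne's (a) of Prop. 4.8): `Hg′(A)(ℂ)|_{H¹} = S(A)(ℂ)`
((a) ⇒ (c) is a theorem of `LefschetzGroup.lean`). [cite: Milne1999LefschetzClasses, Prop. 4.8 (p. 660)] -/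
theorem hodgeGroupOne_eq_unitaryCentralizerGroup_of_forall_isDivisorGenerated
    (hrec : Milne1999_thm44_specialLefschetzGroup_one_eq_unitaryCentralizerGroup)
    (hQ : IsRationalClass h) (hK : ∃ s : ℝ, 0 < s ∧ IsKaehlerClass A.dim A.X ((s : ℂ) • h))
    (hA : ∀ a, IsDivisorGenerated (A.powSucc a)) :
    hodgeGroupOne A.dim A.X = unitaryCentralizerGroup A h :=
  hodgeGroupOne_eq_unitaryCentralizerGroup_of_thm44 hrec hQ hK
    (A.hodgeGroup_eq_specialLefschetzGroup_of_forall_isDivisorGenerated hA)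

end Record

end Literature.AlgebraicGeometry.Milne1999

end
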